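/-
Copyright: harness tree, Literature layer (sorry-free). b2b-lace enum2-g12 (ENUMERATION SHARD B gen 12),
GAPS G8 (δ2)(i), SEEDCERT_U L4 ingredients (b), (c), (d), (e) and the cut estimate.
-/
import Literature.Probability.LatticeModels.SRWHeatKernelHalfAngle
import Mathlib.Analysis.SpecialFunctions.Trigonometric.Chebyshev.RootsExtrema
import Mathlib.MeasureTheory.Integral.Gamma
import HarnessLib

/-!
# Elementary bounds for the half-angle form of `q_t(m) = e^{-t} I_m(t)`

Ingredients of the large-`t` two-sided brackets of the continuous-time SRW kernel in the
half-angle form `q_t(m) = (2/π) ∫₀¹ e^{-2ts²} T_m(1-2s²) (1-s²)^{-1/2} ds`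
(`SRWHeatKernelHalfAngle.srwHeatKernel_eq_integral_halfAngle`):

* `srwHeatKernel_zero_left_zero` (`q_0(0) = 1`) and, through the half-angle form at `t = 0`,
  `m = 0`, the classical `integral_inv_sqrt_one_sub_sq : ∫_{(0,1)} (1-s²)^{-1/2} ds = π/2` and the
  integrability of `(1-s²)^{-1/2}` on `(0,1)`;
* `abs_halfAngleIntegrand_le` — `|e^{-2ts²} T_m(1-2s²)/√(1-s²)| ≤ e^{-2ts²}/√(1-s²) ≤ 1/√(1-s²)`
  on `(0,1)` for `t ≥ 0` (`|T_m| ≤ 1` on `[-1,1]`, Mathlib `abs_eval_T_real_le_one`);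
* `abs_integral_halfAngleIntegrand_cut_le` — the CUT estimate: for `t ≥ 0`, `0 ≤ s₀ ≤ 1`,
  `(2/π) |∫_{(s₀,1)} e^{-2ts²} T_m(1-2s²)(1-s²)^{-1/2} ds| ≤ e^{-2ts₀²}`;
* `integral_pow_mul_exp_neg_mul_sq_Ioi` — the Gaussian moments
  `∫₀^∞ s^{2i} e^{-bs²} ds = (2i-1)‼ √π / (2^{i+1} bⁱ √b)` (`b > 0`), and
* `main_term_halfAngle` — for `u > 0` and any finitely many coefficients `c_i`,
  `(2/π) ∫₀^∞ e^{-2us²} Σ_i c_i s^{2i} ds = (2πu)^{-1/2} Σ_i c_i (2i-1)‼/(4u)ⁱ`, the closed form of the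
  polynomial main term `P(1/u)` of the bracket;
* `integral_pow_mul_exp_neg_mul_sq_Ioi_le` — the COMPLETION error
  `∫_{s₀}^∞ s^{2i} e^{-bs²} ds ≤ (2s₀)^{-1} ∫_{s₀²}^∞ tⁱ e^{-bt} dt` (`t = s²`; exact form
  `integral_pow_mul_exp_neg_mul_sq_Ioi_eq`), and
* `antitoneOn_rpow_mul_exp_neg_mul` / `rpow_mul_exp_neg_mul_le_of_le` — `v ↦ v^a e^{-cv}` is
  non-increasing on `[a/c, ∞)`, so `sup_{v ≥ T} v^a e^{-cv}` is attained at `v = T ≥ a/c`.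

`d`-free, table-free.  References: R. Fitzner, R. van der Hofstad, Electron. J. Probab. 22 (2017),
§5.1.1, pp. 1089–1090 (large-`t` evaluation of the Bessel representation).
[cite: FitznerVanDerHofstad2016NoBLE, §5.1.1 (5.2)-(5.5) p. 1089-1090]; T. Hara, G. Slade,
Rev. Math. Phys. 4 (1992), Appendix B. [cite: HaraSlade1992b, Appendix B]
-/

noncomputable section

open Real MeasureTheory Set Finset Polynomial.Chebyshev
open scoped Nat

namespace Literature.Probability.LatticeModels

/-! ## `q_0(0) = 1` and `∫₀¹ (1-s²)^{-1/2} = π/2` -/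

/-- `q_0(0) = 1`. [folklore] -/
theorem srwHeatKernel_zero_left_zero : srwHeatKernel 0 0 = 1 := by
  rw [srwHeatKernel_eq_div]
  have h : ∀ k : ℝ, srwHeatIntegrandReal 0 0 k = 1 := by
    intro k; simp [srwHeatIntegrandReal]
  simp_rw [h, intervalIntegral.integral_const, smul_eq_mul, mul_one, sub_neg_eq_add]
  field_simp
  ring

/-- At `t = 0`, `m = 0` the half-angle integrand is `(1-s²)^{-1/2}`. [folklore] -/
theorem halfAngleIntegrand_zero_zero (s : ℝ) : halfAngleIntegrand 0 0 s = 1 / √(1 - s ^ 2) := by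
  simp [halfAngleIntegrand]

/-- `∫_{(0,1)} (1-s²)^{-1/2} ds = π/2`. [folklore] -/
theorem integral_inv_sqrt_one_sub_sq : ∫ s in Ioo (0 : ℝ) 1, 1 / √(1 - s ^ 2) = π / 2 := by
  have h := srwHeatKernel_eq_integral_halfAngle 0 0
  rw [srwHeatKernel_zero_left_zero] at h
  simp_rw [halfAngleIntegrand_zero_zero] at h
  have hπ : π ≠ 0 := Real.pi_ne_zero
  field_simp at h
  linarith

/-- `(1-s²)^{-1/2}` is integrable on `(0,1)`. [folklore] -/
theorem integrableOn_inv_sqrt_one_sub_sq : IntegrableOn (fun s : ℝ => 1 / √(1 - s ^ 2)) (Ioo 0 1) := by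
  have h := integrableOn_halfAngleIntegrand 0 0
  have hf : halfAngleIntegrand 0 0 = fun s : ℝ => 1 / √(1 - s ^ 2) :=
    funext halfAngleIntegrand_zero_zero
  rwa [hf] at h

/-! ## Pointwise bounds and the cut estimate -/

/-- `|T_m(1-2s²)| ≤ 1` for `s ∈ [0,1]` (indeed for `s² ≤ 1`). [folklore] -/
theorem abs_eval_T_one_sub_two_mul_sq_le_one (m : ℤ) {s : ℝ} (hs0 : 0 ≤ s) (hs1 : s ≤ 1) :
    |(T ℝ m).eval (1 - 2 * s ^ 2)| ≤ 1 := by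
  apply abs_eval_T_real_le_one
  rw [abs_le]
  constructor <;> nlinarith [mul_nonneg hs0 hs0, mul_le_one₀ hs1 hs0 hs1]

/-- For `t ≥ 0` and `s ∈ (0,1)`: `|e^{-2ts²} T_m(1-2s²)/√(1-s²)| ≤ e^{-2ts²}/√(1-s²)`. [folklore] -/
theorem abs_halfAngleIntegrand_le (t : ℝ) (m : ℤ) {s : ℝ} (hs : s ∈ Ioo (0 : ℝ) 1) :
    |halfAngleIntegrand t m s| ≤ Real.exp (-(2 * t * s ^ 2)) / √(1 - s ^ 2) := by
  have hsq : 0 < √(1 - s ^ 2) := Real.sqrt_pos.2 (by nlinarith [hs.1, hs.2])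
  rw [halfAngleIntegrand, abs_div, abs_mul, abs_of_pos (Real.exp_pos _), abs_of_pos hsq]
  gcongr
  calc Real.exp (-(2 * t * s ^ 2)) * |(T ℝ m).eval (1 - 2 * s ^ 2)|
      ≤ Real.exp (-(2 * t * s ^ 2)) * 1 := by
        gcongr; exact abs_eval_T_one_sub_two_mul_sq_le_one m hs.1.le hs.2.le
    _ = _ := mul_one _

/-- For `t ≥ 0`, `0 ≤ s₀` and `s ∈ (s₀,1)`, `s₀ < 1`:
`|e^{-2ts²} T_m(1-2s²)/√(1-s²)| ≤ e^{-2ts₀²}/√(1-s²)`. [folklore] -/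
theorem abs_halfAngleIntegrand_le_of_le {t : ℝ} (ht : 0 ≤ t) (m : ℤ) {s₀ s : ℝ} (hs₀ : 0 ≤ s₀)
    (hs : s ∈ Ioo s₀ 1) :
    |halfAngleIntegrand t m s| ≤ Real.exp (-(2 * t * s₀ ^ 2)) / √(1 - s ^ 2) := by
  have hs' : s ∈ Ioo (0 : ℝ) 1 := ⟨lt_of_le_of_lt hs₀ hs.1, hs.2⟩
  refine (abs_halfAngleIntegrand_le t m hs').trans ?_
  have hsq : 0 < √(1 - s ^ 2) := Real.sqrt_pos.2 (by nlinarith [hs'.1, hs'.2])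
  gcongr
  · exact hs.1.le

/-- **Cut estimate.**  For `t ≥ 0`, `0 ≤ s₀` (vacuous beyond `s₀ ≥ 1`):
`(2/π) |∫_{(s₀,1)} e^{-2ts²} T_m(1-2s²) (1-s²)^{-1/2} ds| ≤ e^{-2ts₀²}`
(`|T_m| ≤ 1`, `e^{-2ts²} ≤ e^{-2ts₀²}` and `∫_{(s₀,1)} (1-s²)^{-1/2} ≤ π/2`).
[cite: FitznerVanDerHofstad2016NoBLE, §5.1.1 (5.2)-(5.5) p. 1089-1090] -/
theorem abs_integral_halfAngleIntegrand_cut_le {t : ℝ} (ht : 0 ≤ t) (m : ℤ) {s₀ : ℝ}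
    (hs₀ : 0 ≤ s₀) :
    2 / π * |∫ s in Ioo s₀ 1, halfAngleIntegrand t m s| ≤ Real.exp (-(2 * t * s₀ ^ 2)) := by
  have hsub : Ioo s₀ 1 ⊆ Ioo (0 : ℝ) 1 := fun s hs => ⟨lt_of_le_of_lt hs₀ hs.1, hs.2⟩
  have hI : IntegrableOn (fun s : ℝ => 1 / √(1 - s ^ 2)) (Ioo s₀ 1) :=
    integrableOn_inv_sqrt_one_sub_sq.mono_set hsub
  have h1 : |∫ s in Ioo s₀ 1, halfAngleIntegrand t m s|
      ≤ ∫ s in Ioo s₀ 1, Real.exp (-(2 * t * s₀ ^ 2)) / √(1 - s ^ 2) := by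
    refine (abs_integral_le_integral_abs).trans ?_
    refine setIntegral_mono_on ((integrableOn_halfAngleIntegrand t m).mono_set hsub).abs
      ?_ measurableSet_Ioo fun s hs => abs_halfAngleIntegrand_le_of_le ht m hs₀ hs
    have : IntegrableOn (fun s : ℝ => Real.exp (-(2 * t * s₀ ^ 2)) * (1 / √(1 - s ^ 2))) (Ioo s₀ 1) :=
      hI.const_mul _
    exact this.congr_fun (fun s _ => by ring) measurableSet_Ioo
  have h2 : ∫ s in Ioo s₀ 1, Real.exp (-(2 * t * s₀ ^ 2)) / √(1 - s ^ 2)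
      = Real.exp (-(2 * t * s₀ ^ 2)) * ∫ s in Ioo s₀ 1, 1 / √(1 - s ^ 2) := by
    rw [← integral_const_mul]
    refine setIntegral_congr_fun measurableSet_Ioo fun s _ => by ring
  have h3 : ∫ s in Ioo s₀ 1, 1 / √(1 - s ^ 2) ≤ π / 2 := by
    rw [← integral_inv_sqrt_one_sub_sq]
    exact setIntegral_mono_set integrableOn_inv_sqrt_one_sub_sq
      (ae_restrict_of_forall_mem measurableSet_Ioo fun s hs =>
        div_nonneg zero_le_one (Real.sqrt_nonneg _))
      (Filter.Eventually.of_forall hsub)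
  have hπ : 0 < π := Real.pi_pos
  calc 2 / π * |∫ s in Ioo s₀ 1, halfAngleIntegrand t m s|
      ≤ 2 / π * (Real.exp (-(2 * t * s₀ ^ 2)) * (π / 2)) := by
        rw [h2] at h1
        gcongr
        exact h1.trans (mul_le_mul_of_nonneg_left h3 (Real.exp_pos _).le)
    _ = Real.exp (-(2 * t * s₀ ^ 2)) := by field_simp

/-! ## Gaussian moments and the polynomial main term -/

/-- **Gaussian moments**: for `b > 0`, `∫₀^∞ s^{2i} e^{-bs²} ds = (2i-1)‼ √π / (2^{i+1} bⁱ √b)`. [folklore] -/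
theorem integral_pow_mul_exp_neg_mul_sq_Ioi (i : ℕ) {b : ℝ} (hb : 0 < b) :
    ∫ s in Ioi (0 : ℝ), s ^ (2 * i) * Real.exp (-(b * s ^ 2))
      = ((2 * i - 1)‼ : ℝ) * √π / (2 ^ (i + 1) * b ^ i * √b) := by
  have h := integral_rpow_mul_exp_neg_mul_rpow (p := 2) (q := (2 * i : ℕ)) (b := b) two_pos
    (by have : (0 : ℝ) ≤ ((2 * i : ℕ) : ℝ) := Nat.cast_nonneg _; linarith) hb
  have hlhs : ∫ s in Ioi (0 : ℝ), s ^ (2 * i) * Real.exp (-(b * s ^ 2))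
      = ∫ s in Ioi (0 : ℝ), s ^ (((2 * i : ℕ) : ℝ)) * Real.exp (-b * s ^ (2 : ℝ)) := by
    refine setIntegral_congr_fun measurableSet_Ioi fun s _ => ?_
    rw [Real.rpow_natCast, Real.rpow_two, neg_mul]
  rw [hlhs, h]
  have hq : (((2 * i : ℕ) : ℝ) + 1) / 2 = (i : ℝ) + 1 / 2 := by push_cast; ring
  rw [hq, Real.Gamma_nat_add_half i]
  have hneg : -(((2 * i : ℕ) : ℝ) + 1) / 2 = -((i : ℝ) + 1 / 2) := by push_cast; ring
  rw [hneg, Real.rpow_neg hb.le, Real.rpow_add hb, Real.rpow_natCast, ← Real.sqrt_eq_rpow]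
  field_simp
  ring

/-- `∫₀^∞ s^{2i} e^{-2us²} ds`-terms are integrable (`u > 0`). [folklore] -/
theorem integrableOn_pow_mul_exp_neg_mul_sq_Ioi (i : ℕ) {b : ℝ} (hb : 0 < b) :
    IntegrableOn (fun s : ℝ => s ^ (2 * i) * Real.exp (-(b * s ^ 2))) (Ioi 0) := by
  have h := integrableOn_rpow_mul_exp_neg_mul_rpow (p := 2) (s := (2 * i : ℕ)) (b := b)
    (by have : (0 : ℝ) ≤ ((2 * i : ℕ) : ℝ) := Nat.cast_nonneg _; linarith) (by norm_num) hb
  refine h.congr_fun (fun s _ => ?_) measurableSet_Ioi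
  simp only
  rw [Real.rpow_natCast, Real.rpow_two, neg_mul]

/-- **The polynomial main term.**  For `u > 0` and coefficients `c₀,…,c_{N-1}`:
`(2/π) ∫₀^∞ e^{-2us²} Σ_{i<N} c_i s^{2i} ds = (2πu)^{-1/2} Σ_{i<N} c_i (2i-1)‼/(4u)ⁱ`.
[cite: FitznerVanDerHofstad2016NoBLE, §5.1.1 (5.2)-(5.5) p. 1089-1090] -/
theorem main_term_halfAngle {u : ℝ} (hu : 0 < u) (c : ℕ → ℝ) (N : ℕ) :
    2 / π * ∫ s in Ioi (0 : ℝ), Real.exp (-(2 * u * s ^ 2)) * ∑ i ∈ range N, c i * s ^ (2 * i)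
      = 1 / √(2 * π * u) * ∑ i ∈ range N, c i * ((2 * i - 1)‼ : ℝ) / (4 * u) ^ i := by
  have hb : 0 < 2 * u := by positivity
  have hint : ∀ i ∈ range N, IntegrableOn
      (fun s : ℝ => c i * (s ^ (2 * i) * Real.exp (-(2 * u * s ^ 2)))) (Ioi 0) :=
    fun i _ => (integrableOn_pow_mul_exp_neg_mul_sq_Ioi i hb).const_mul (c i)
  have hswap : ∫ s in Ioi (0 : ℝ), Real.exp (-(2 * u * s ^ 2)) * ∑ i ∈ range N, c i * s ^ (2 * i)
      = ∑ i ∈ range N, c i * ∫ s in Ioi (0 : ℝ), s ^ (2 * i) * Real.exp (-(2 * u * s ^ 2)) :=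
    calc ∫ s in Ioi (0 : ℝ), Real.exp (-(2 * u * s ^ 2)) * ∑ i ∈ range N, c i * s ^ (2 * i)
        = ∫ s in Ioi (0 : ℝ), ∑ i ∈ range N, c i * (s ^ (2 * i) * Real.exp (-(2 * u * s ^ 2))) := by
          refine setIntegral_congr_fun measurableSet_Ioi fun s _ => ?_
          rw [Finset.mul_sum]
          refine Finset.sum_congr rfl fun i _ => ?_
          ring
      _ = ∑ i ∈ range N, ∫ s in Ioi (0 : ℝ), c i * (s ^ (2 * i) * Real.exp (-(2 * u * s ^ 2))) :=
          integral_finsetSum _ hint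
      _ = _ := Finset.sum_congr rfl fun i _ => integral_const_mul _ _
  rw [hswap]
  simp_rw [integral_pow_mul_exp_neg_mul_sq_Ioi _ hb, Finset.mul_sum]
  refine Finset.sum_congr rfl fun i _ => ?_
  have hπ : 0 < π := Real.pi_pos
  have hsu : √(2 * π * u) = √π * √(2 * u) := by
    rw [show 2 * π * u = π * (2 * u) by ring, Real.sqrt_mul Real.pi_pos.le]
  have hsπ : √π ≠ 0 := (Real.sqrt_pos.2 hπ).ne'
  have hs2 : √(2 * u) ≠ 0 := (Real.sqrt_pos.2 hb).ne'
  rw [hsu, show (4 * u) ^ i = 2 ^ i * (2 * u) ^ i by rw [← mul_pow]; ring]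
  field_simp
  rw [Real.sq_sqrt hπ.le]
  ring

/-! ## The completion error and the monotonicity of `v^a e^{-cv}` -/

/-- `s ↦ s²` maps `(s₀,∞)` onto `(s₀²,∞)` for `s₀ ≥ 0`. [folklore] -/
theorem image_sq_Ioi {s₀ : ℝ} (hs₀ : 0 ≤ s₀) : (fun s : ℝ => s ^ 2) '' Ioi s₀ = Ioi (s₀ ^ 2) := by
  apply Set.Subset.antisymm
  · rintro t ⟨s, hs, rfl⟩
    exact pow_lt_pow_left₀ hs hs₀ two_ne_zero
  · intro t ht
    have ht0 : 0 ≤ t := le_trans (sq_nonneg _) (le_of_lt ht)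
    refine ⟨√t, ?_, Real.sq_sqrt ht0⟩
    show s₀ < √t
    calc s₀ = √(s₀ ^ 2) := (Real.sqrt_sq hs₀).symm
      _ < √t := Real.sqrt_lt_sqrt (sq_nonneg _) ht

/-- **Completion error, exact form**: for `s₀ ≥ 0`,
`∫_{(s₀,∞)} s^{2i} e^{-bs²} ds = ∫_{(s₀²,∞)} tⁱ e^{-bt} /(2√t) dt` (`t = s²`). [folklore] -/
theorem integral_pow_mul_exp_neg_mul_sq_Ioi_eq (i : ℕ) (b : ℝ) {s₀ : ℝ} (hs₀ : 0 ≤ s₀) :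
    ∫ s in Ioi s₀, s ^ (2 * i) * Real.exp (-(b * s ^ 2))
      = ∫ t in Ioi (s₀ ^ 2), t ^ i * Real.exp (-(b * t)) / (2 * √t) := by
  have hcv := integral_image_eq_integral_abs_deriv_smul (s := Ioi s₀)
    (f := fun s : ℝ => s ^ 2) (f' := fun s => 2 * s) measurableSet_Ioi
    (fun s _ => ((hasDerivAt_pow 2 s).congr_deriv (by simp [pow_one])).hasDerivWithinAt)
    (fun a ha b hb hab => by
      have ha0 : 0 ≤ a := hs₀.trans (le_of_lt ha)
      have hb0 : 0 ≤ b := hs₀.trans (le_of_lt hb)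
      simpa using (pow_left_inj₀ ha0 hb0 two_ne_zero).1 hab)
    (fun t : ℝ => t ^ i * Real.exp (-(b * t)) / (2 * √t))
  rw [image_sq_Ioi hs₀] at hcv
  rw [hcv]
  refine setIntegral_congr_fun measurableSet_Ioi fun s hs => ?_
  have hs0 : 0 < s := lt_of_le_of_lt hs₀ hs
  simp only [smul_eq_mul]
  rw [abs_of_pos (by positivity : (0 : ℝ) < 2 * s), Real.sqrt_sq hs0.le, ← pow_mul, mul_comm 2 i]
  field_simp

/-- `tⁱ e^{-bt}` is integrable on `(σ,∞)` for `b > 0`, `σ ≥ 0`. [folklore] -/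
theorem integrableOn_pow_mul_exp_neg_mul_Ioi' (i : ℕ) {b σ : ℝ} (hb : 0 < b) (hσ : 0 ≤ σ) :
    IntegrableOn (fun t : ℝ => t ^ i * Real.exp (-(b * t))) (Ioi σ) := by
  have h := integrableOn_rpow_mul_exp_neg_mul_rpow (p := 1) (s := (i : ℕ)) (b := b)
    (by have : (0 : ℝ) ≤ ((i : ℕ) : ℝ) := Nat.cast_nonneg _; linarith) le_rfl hb
  refine (h.mono_set (Ioi_subset_Ioi hσ)).congr_fun (fun t _ => ?_) measurableSet_Ioi
  simp only
  rw [Real.rpow_natCast, Real.rpow_one, neg_mul]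

/-- **Completion error, bound** (SEEDCERT_U L4 (d)): for `s₀ > 0`, `b > 0`,
`∫_{(s₀,∞)} s^{2i} e^{-bs²} ds ≤ (1/(2s₀)) ∫_{(s₀²,∞)} tⁱ e^{-bt} dt`
(the right-hand integral is an incomplete Gamma function with the closed form
`(i!/b^{i+1}) e^{-bσ} Σ_{j≤i} (bσ)^j/j!`, `σ = s₀²`).
[cite: FitznerVanDerHofstad2016NoBLE, §5.1.1 (5.2)-(5.5) p. 1089-1090] -/
theorem integral_pow_mul_exp_neg_mul_sq_Ioi_le (i : ℕ) {b s₀ : ℝ} (hb : 0 < b) (hs₀ : 0 < s₀) :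
    ∫ s in Ioi s₀, s ^ (2 * i) * Real.exp (-(b * s ^ 2))
      ≤ 1 / (2 * s₀) * ∫ t in Ioi (s₀ ^ 2), t ^ i * Real.exp (-(b * t)) := by
  rw [integral_pow_mul_exp_neg_mul_sq_Ioi_eq i b hs₀.le, ← integral_const_mul]
  have hI := integrableOn_pow_mul_exp_neg_mul_Ioi' i hb (sq_nonneg s₀)
  refine setIntegral_mono_on ?_ (hI.const_mul _) measurableSet_Ioi fun t ht => ?_
  · -- integrability of the exact integrand: dominated by the right-hand side on `(s₀², ∞)`
    refine Integrable.mono' (hI.const_mul (1 / (2 * s₀))) ?_ ?_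
    · have hc : ContinuousOn (fun t : ℝ => t ^ i * Real.exp (-(b * t)) / (2 * √t)) (Ioi (s₀ ^ 2)) := by
        refine ContinuousOn.div (by fun_prop) (by fun_prop) fun t ht => ?_
        have : 0 < t := lt_trans (by positivity) ht
        positivity
      exact hc.aestronglyMeasurable measurableSet_Ioi
    · refine ae_restrict_of_forall_mem measurableSet_Ioi fun t ht => ?_
      have ht0 : 0 < t := lt_trans (by positivity) ht
      have hst : s₀ ≤ √t := by
        calc s₀ = √(s₀ ^ 2) := (Real.sqrt_sq hs₀.le).symm
          _ ≤ √t := Real.sqrt_le_sqrt (le_of_lt ht)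
      rw [Real.norm_eq_abs, abs_of_nonneg (by positivity)]
      rw [div_eq_mul_inv, one_div, mul_comm (2 * s₀)⁻¹]
      gcongr
  · have ht0 : 0 < t := lt_trans (by positivity) ht
    have hst : s₀ ≤ √t := by
      calc s₀ = √(s₀ ^ 2) := (Real.sqrt_sq hs₀.le).symm
        _ ≤ √t := Real.sqrt_le_sqrt (le_of_lt ht)
    rw [div_eq_mul_inv, one_div, mul_comm (2 * s₀)⁻¹]
    gcongr

/-- **Monotonicity of `v^a e^{-cv}`** (SEEDCERT_U L4 (e)): for `a ≥ 0`, `c > 0` the function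
`v ↦ v^a e^{-cv}` is non-increasing on `[a/c, ∞)`. [folklore] -/
theorem antitoneOn_rpow_mul_exp_neg_mul {a c : ℝ} (ha : 0 ≤ a) (hc : 0 < c) :
    AntitoneOn (fun v : ℝ => v ^ a * Real.exp (-(c * v))) (Ici (a / c)) := by
  have hac : 0 ≤ a / c := div_nonneg ha hc.le
  have hderiv : ∀ v : ℝ, 0 < v → HasDerivAt (fun v : ℝ => v ^ a * Real.exp (-(c * v)))
      (a * v ^ (a - 1) * Real.exp (-(c * v)) + v ^ a * (Real.exp (-(c * v)) * (-c))) v := by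
    intro v hv
    have h1 : HasDerivAt (fun v : ℝ => v ^ a) (a * v ^ (a - 1)) v :=
      Real.hasDerivAt_rpow_const (Or.inl hv.ne')
    have h2 : HasDerivAt (fun v : ℝ => Real.exp (-(c * v))) (Real.exp (-(c * v)) * (-c)) v := by
      have h := (hasDerivAt_id v).const_mul (-c)
      have h' : HasDerivAt (fun v : ℝ => -(c * v)) (-c) v := by
        refine (h.congr_deriv (by simp)).congr_of_eventuallyEq ?_
        exact Filter.Eventually.of_forall fun x => by simp [neg_mul]
      exact h'.exp
    exact h1.mul h2
  refine antitoneOn_of_deriv_nonpos (convex_Ici _) ?_ ?_ ?_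
  · exact ((Real.continuous_rpow_const ha).mul (by fun_prop)).continuousOn
  · rw [interior_Ici]
    intro v hv
    have hv0 : 0 < v := lt_of_le_of_lt hac hv
    exact (hderiv v hv0).differentiableAt.differentiableWithinAt
  · rw [interior_Ici]
    intro v hv
    have hv0 : 0 < v := lt_of_le_of_lt hac hv
    rw [(hderiv v hv0).deriv]
    have hcv : a ≤ c * v := by
      have := (div_lt_iff₀ hc).1 hv
      linarith [this]
    have hva : v ^ a = v * v ^ (a - 1) := by
      have h := Real.rpow_add hv0 1 (a - 1)
      rw [show (1 : ℝ) + (a - 1) = a by ring, Real.rpow_one] at h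
      exact h
    rw [hva]
    have hpos : 0 ≤ v ^ (a - 1) * Real.exp (-(c * v)) := by positivity
    nlinarith [hpos, hcv]

/-- For `a ≥ 0`, `c > 0`, `T ≥ a/c` and `v ≥ T`: `v^a e^{-cv} ≤ T^a e^{-cT}` — the supremum over
`v ≥ T` is attained at `v = T`. [folklore] -/
theorem rpow_mul_exp_neg_mul_le_of_le {a c T v : ℝ} (ha : 0 ≤ a) (hc : 0 < c) (hT : a / c ≤ T)
    (hv : T ≤ v) : v ^ a * Real.exp (-(c * v)) ≤ T ^ a * Real.exp (-(c * T)) :=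
  antitoneOn_rpow_mul_exp_neg_mul ha hc (mem_Ici.2 hT) (mem_Ici.2 (hT.trans hv)) hv

end Literature.Probability.LatticeModels
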